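import Summits.HodgeConjecture.HodgeConjecture.Theorems.Ring2AbelianAllOneAnchorWeilCarrierDefs
import Summits.HodgeConjecture.HodgeConjecture.Theorems.VHCAbelianSchemesRoadServedFibreLocal
import Literature.AlgebraicGeometry.HodgeTheory.HyperbolicWeilTypeExistence
import HarnessLib

/-!
# Ring 2 / AbelianAll (André column) × the Weil ladder — THE ONE-ANCHOR JUNCTION: door ∧ ONE carrier for ONE Weil class on ONE hyperbolic
# Weil-type variety ⟹ the ladder's local anchor predicate ⟹ (reach) every hyperbolic member; the split rungs and Markman's hyperbolic
# sixfolds from the road's binders and ONE carrier node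

research route, not a corollary; conditional on HC_CM plus one named minimal statement.

PART AC-d (`Ring2AbelianAllOneAnchorWeilCarrierDefs`) named the smallest carrier statement of the column for the hyperbolic Weil problem,
`OneHyperbolicWeilCarrier 𝒪 n d` / `OneHyperbolicWeilTwistedCarrier n d`: ONE hyperbolic `√-d`-Weil `2n`-fold `(P, ψ₀, e, a)` with ONE
non-zero rational Weil class `w` and, on every copy of `P`, an `𝒪`-admissible datum serving `w` modulo the `h_K`-ray. This file proves:

* §1 **`hasLocallyAlgebraicWeilAnchor_of_door_of_oneHyperbolicWeilCarrier : LocalVariationalHodgeFor 𝒪 → OneHyperbolicWeilCarrier 𝒪 n d →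
  HodgeTheory.HasLocallyAlgebraicWeilAnchor n d`** — the JUNCTION, door-generic and fact-free: along any Weil family with global `H`, `W`
  restricting on the chart `e' : P ≅ 𝒳_{s₀}` to `h_K`, `w`, the fibre `(𝒳_{s₀}, H|_{s₀})` is a chart of the anchor and `W|_{s₀}` is served,
  so the LOCAL served-fibre lemma (PART AC-a §2, `Θ := H`, base of any dimension) gives an open `U ∋ s₀` with `W|_{𝒳_s}` algebraic on `U`
  (`q = 0`). Twisted form per `C`. Compare the ladder's OBJECT-level cut `hasLocallyAlgebraicWeilAnchor_of_perryTwisted_kappaAnchorObject`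
  (Perry's twisted theorem + a FULLY semiregular vector bundle): here the door is a parameter and the object an `𝒪`-admissible datum
  (for the road's door: a `B`-twisted `AdmTw`-admissible perfect complex, partial degree sets allowed).
* §2 ANTI-VACUITY of the anchor data (`exists_anchorData_oneHyperbolicWeilCarrier`: for `n ≥ 2`, `d ≥ 1` a hyperbolic `(P, ψ₀, e, a)` with a
  non-zero rational Weil class EXISTS — the tree's `exists_isHyperbolicWeilType_with_weilClass`), so the node is the carrier clause alone; and
  `OneHyperbolicWeilCarrier.mono` (monotone in the door). (No edge from `AbelianDesigns 𝒪` is recorded here: that would need the served Weil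
  class to be ALGEBRAIC on the chosen hyperbolic anchor, which the tree knows at TENSOR points — companion file `Ring2AbelianAllTensorWeilCarriers`
  §2 — but not for an arbitrary hyperbolic member.)
* The ROWS (with the reach fact `weilFamilyReach_hyperbolic` and the ladder's `weilClasses_algebraic_hyperbolic_of_localAnchor`: every hyperbolic
  member; `SplitEightfolds`, `SplitWeilAbelianVarieties`, `Markman2025_weilClasses_algebraic_hyperbolicSixfold` from the road's binders and ONE
  carrier per `d`) are the companion LEAF file `Ring2AbelianAllOneAnchorWeilCarrierRows` (it imports route files; this file does not).

HONEST: both carrier nodes are OPEN (`n ≥ 4`) / preprint-expected (`n = 3`, secant anchor), not implied by HC; `weilFamilyReach_hyperbolic` is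
the ladder's NAMED FACT (Deligne 1982 / van Geemen / Landherr / MFK / Milne; refereed inputs, by name); the door is the road's binder
`TwistedPerfectDoor` (labels of the route file apply; for the `bfSingleAdmissible` disjunct print supports `B₀ = 0` — BF Thm. 5.1 — or degree
sets with `{q | q+1 ∈ I}` an initial segment; RING2-MAP §AbelianAll AA2.487). Nothing here says any carrier, door, rung, `HC_CM`, `HC_AV` or
HC holds; `HC_CM` does not occur. References: [cite: Markman2025SecantWeil, Thm. 1.4.1, Thm. 1.5.1, §1.2 and §1.5]
[cite: Deligne1982HodgeCycles, §4 proof of Thm. 4.8] [cite: vanGeemen1994HodgeAV, Lemma 5.2, 5.4 and proof of Thm. 6.12]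
[cite: BuchweitzFlenner2003, §5 Thm. 5.1] [cite: Bloch1972Semiregularity, Remark (7.5)] [cite: Pridham2024Semiregularity, Cor. 2.25 and Rem. 2.26–2.27].
-/

noncomputable section

open CategoryTheory CategoryTheory.Limits AlgebraicGeometry Topology

namespace Summit.HodgeConjecture.HodgeConjecture.Ring2.AbelianAll

-- the cell's namespace repeats the summit name (`Summit.HodgeConjecture.HodgeConjecture…`), as in every `Ring2*` file
set_option linter.dupNamespace false

open Literature.AlgebraicGeometry Literature.AlgebraicGeometry.Motives
open Literature.AlgebraicGeometry.HodgeTheory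
open Literature.AlgebraicTopology.SingularHomology
open Summit.Ventures.HSemireg (ObjClass LocalVariationalHodgeFor)
open Summit.HodgeConjecture.HodgeConjecture.Ring2.SemiregularRepresentatives (AnchoredCarrierAt
  twistedPerfectDoorVHC_iff_localVariationalHodgeFor exists_isOpen_forall_mem_algebraicClasses_of_anchoredCarrierAt_at)

variable {𝒪 : ObjClass} {n d : ℕ}

/-! ## §1 The junction: door ∧ one carrier ⟹ the ladder's local anchor predicate -/

/-- **THE ONE-ANCHOR JUNCTION**: the door's local variational Hodge statement and ONE carrier for ONE non-zero rational Weil class on ONE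
hyperbolic Weil-type `2n`-fold give the Weil ladder's `HasLocallyAlgebraicWeilAnchor n d`, with `q = 0`: along a family of the predicate the
fibre `(𝒳_{s₀}, H|_{s₀})` is a chart of the anchor (`e'^*(H|_{s₀}) = h_K`), the class `W|_{s₀}` is served (`e'^*(W|_{s₀}) = w`) and rational, and
the LOCAL served-fibre lemma with `Θ := H` (PART AC-a §2; smooth base of any dimension) makes `W|_{𝒳_s}` algebraic on an open `U ∋ s₀`.
Door-generic, fact-free. [cite: BuchweitzFlenner2003, §5 Thm. 5.1] [cite: Markman2025SecantWeil, §1.5] [cite: Bloch1972Semiregularity, Remark (7.5)] -/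
theorem hasLocallyAlgebraicWeilAnchor_of_door_of_oneHyperbolicWeilCarrier (hT : LocalVariationalHodgeFor 𝒪)
    (hcar : OneHyperbolicWeilCarrier 𝒪 n d) : HasLocallyAlgebraicWeilAnchor n d := by
  obtain ⟨P, ψ₀, e, a, w, hP, hψ, ha, ha0, hhyp, hwW, hwrat, hw0, hA⟩ := hcar
  refine ⟨P, ψ₀, e, a, w, hP, hψ, ha, ha0, hhyp, hwW, hwrat, hw0, ?_⟩
  intro 𝒳 S f hf _ _ _ hsm _ H W hH hW s₀ e' hH₀ hW₀
  obtain ⟨U, hUo, hU₀, halg⟩ := exists_isOpen_forall_mem_algebraicClasses_of_anchoredCarrierAt_at hT hA hf hsm H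
    (fun s ↦ (hH s).1) (fun s ↦ (hH s).2) W hW s₀ ⟨e', hH₀⟩ ⟨e', hH₀, hW₀⟩
  refine ⟨U, 0, hUo, hU₀, fun s hs ↦ ?_⟩
  rw [Rat.cast_zero, zero_smul, zero_add]
  exact halg s hs

/-- **Twisted-door form of the junction, per `C`** (route binder `TwistedPerfectDoorVHC C AdmTw` by name, any admissibility notion).
[cite: Pridham2024Semiregularity, Cor. 2.25 and Rem. 2.26–2.27] [cite: BuchweitzFlenner2003, §5 Thm. 5.1] -/
theorem hasLocallyAlgebraicWeilAnchor_of_twistedPerfectDoorVHC_of_oneHyperbolicWeilCarrier {C : ChernCharacterBetti} {Adm : PerfectAdmissibility}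
    (hT : TwistedPerfectDoorVHC C Adm) (hcar : OneHyperbolicWeilCarrier (twistedReflexiveClass C Adm) n d) :
    HasLocallyAlgebraicWeilAnchor n d :=
  hasLocallyAlgebraicWeilAnchor_of_door_of_oneHyperbolicWeilCarrier ((twistedPerfectDoorVHC_iff_localVariationalHodgeFor C Adm).1 hT) hcar

/-! ## §2 Anti-vacuity of the anchor data; monotonicity in the door -/

/-- **The anchor data of the node EXIST** (`n ≥ 2`, `d ≥ 1`): a hyperbolic `√-d`-Weil `2n`-fold `(P, ψ₀, e, a)` with a non-zero RATIONAL Weil class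
— the tree's `exists_isHyperbolicWeilType_with_weilClass` (products of Weil surfaces; van Geemen 5.5 / Schoen §7 / Markman survey §11.5, PROVED).
So `OneHyperbolicWeilCarrier 𝒪 n d` is the CARRIER clause alone, not an existence claim about hyperbolic varieties.
[cite: vanGeemen1994HodgeAV, 5.5 and Lemma 5.2] [cite: Markman2025SurveySecant, §11.5 Step 2] -/
theorem exists_anchorData_oneHyperbolicWeilCarrier (hn : 2 ≤ n) (hd : 0 < d) :
    ∃ (P : AbelianVariety ℂ) (ψ₀ : P ⟶ P) (e : ProjectiveEmbedding P.X) (a : complexBetti (projectiveSpace e.n ℂ) 2)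
      (w : complexBetti P.X (2 * n)),
      P.dim = 2 * n ∧ ψ₀ ≫ ψ₀ = -(d • 𝟙 P) ∧ IsRationalClass a ∧ a ≠ 0 ∧
      IsHyperbolicWeilType P ψ₀ n ((d : ℂ) • complexBetti.map e.ι 2 a + complexBetti.map ψ₀.hom.hom.hom 2 (complexBetti.map e.ι 2 a)) ∧
      w ∈ weilClassesOf P ψ₀ n d ∧ IsRationalClass w ∧ w ≠ 0 := by
  obtain ⟨P, ψ₀, e, a, w, hP, hψ, ha, ha0, hhyp, hwW, hwrat, hw0, -⟩ := exists_isHyperbolicWeilType_with_weilClass n d hn hd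
  exact ⟨P, ψ₀, e, a, w, hP, hψ, ha, ha0, hhyp, hwW, hwrat, hw0⟩

/-- **Monotonicity in the door**: a LARGER object class (more admissible data) makes the one-carrier statement WEAKER to ask — if every
`𝒪`-datum is an `𝒪'`-datum then `OneHyperbolicWeilCarrier 𝒪 n d ⟹ OneHyperbolicWeilCarrier 𝒪' n d`. [folklore] [cite: Bloch1972Semiregularity, Remark (7.5)] -/
theorem OneHyperbolicWeilCarrier.mono {𝒪' : ObjClass} (h𝒪 : ∀ m X I κ, 𝒪 m X I κ → 𝒪' m X I κ) (h : OneHyperbolicWeilCarrier 𝒪 n d) :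
    OneHyperbolicWeilCarrier 𝒪' n d := by
  obtain ⟨P, ψ₀, e, a, w, hP, hψ, ha, ha0, hhyp, hwW, hwrat, hw0, hA⟩ := h
  refine ⟨P, ψ₀, e, a, w, hP, hψ, ha, ha0, hhyp, hwW, hwrat, hw0, fun X θ hXθ w' hw' hw'Q ↦ ?_⟩
  obtain ⟨I, κ, a', c, hnI, hκ𝒪, ha', hκn, hκq⟩ := hA X θ hXθ w' hw' hw'Q
  exact ⟨I, κ, a', c, hnI, h𝒪 _ _ _ _ hκ𝒪, ha', hκn, hκq⟩

end Summit.HodgeConjecture.HodgeConjecture.Ring2.AbelianAll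

end
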